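import Summits.Ventures.LatticeQCDFlow.Exactness.Phi4HMCExact
import Summits.Ventures.LatticeQCDFlow.Scoring.SchwingerDysonWickLinear
import HarnessLib

/-!
# The refreshed momenta: two-point and four-point moments, the total momentum, and the variance of the kinetic energy

HONEST FRAMING: exact (Metropolis-corrected) sampling algorithms for lattice gauge theory;
figures of merit are autocorrelation/cost numbers at stated couplings and volumes; no
continuum-physics claim.  (SCALAR calibration rung S0-A: not a gauge result.)

Venture `LatticeQCDFlow` (cell pub-lqcd), topic `Exactness`; FANOUT row 2 (`s0-phi4`, HMC arm).
NEW WORK of the cell, a bookkeeping file: the Gaussian facts about the momentum refresh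
`p ∼ N(0,1)^Λ` that the HMC critical-slowing-down floors consume, obtained WITHOUT computing a
Gaussian integral — the refresh law is the Gibbs law of the diagonal free action
`latticePhi4Action (halfDiag n) 0 p = ½ Σ p²` (`Phi4HMCExact.momentumWeight_eq_gibbsWeight`), so
row 2's Schwinger–Dyson files apply verbatim: the two-point function from `free_propagator_sd`,
the four-point function from Wick's theorem `wick_four_point`, the square of a linear functional
from `gibbs_linear_sq_of_coercive`.  Nothing is cited as a fact (Wick/Isserlis is folklore; the
tree's proof is the cell's Schwinger–Dyson one).

## What is proved (`Λ = Fin (n+1)`, `V = n+1`, `⟨·⟩_p = gibbsExpect (halfDiag n) 0`)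

* `momentum_quadForm` — `Σ_{xy} p_x (½𝟙)_{xy} p_y = ½ Σ p²`; `momentum_coercive` — the coercivity
  hypothesis `½ Σ p² − 0 ≤ S_p(p)` of the Schwinger–Dyson files; `momentumZ_eq_gibbsZ`;
* **`momentum_two_point`** — `⟨p_x p_y⟩_p = δ_{xy}`; `momentum_sq` — `⟨p_x²⟩_p = 1`;
* **`momentum_four_point`** — `⟨p_x² p_y²⟩_p = 1 + 2δ_{xy}` (Wick);
* **`momentum_totalSq`** — `⟨(Σ_x p_x)²⟩_p = V` (the TOTAL MOMENTUM has variance `V`);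
* **`momentum_kinetic_var`** — `⟨(½Σp² − V/2)²⟩_p = V/2` (the KINETIC ENERGY has mean `V/2` and
  variance `V/2`);
* `integral_totalSq_mul_momentumWeight`, `integral_kinetic_dev_sq_mul_momentumWeight` — the same two
  as unnormalised integrals against `e^{−½Σp²} dp` (`= V·Z_p`, `= (V/2)·Z_p`).

Used by `Exactness/Phi4HMCActionCSD.lean` (kinetic-exchange floor for the action) and
`Exactness/Phi4HMCOneStepCSD.lean` (total-momentum floor for the magnetisation).
-/

namespace Summit.Ventures.LatticeQCDFlow.Exactness

open Real MeasureTheory Finset Filter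
open Summit.Ventures.LatticeQCDFlow.Scoring

section Momenta

variable {n : ℕ}

/-- The quadratic form of the diagonal coupling `½𝟙` is half the sum of squares. -/
theorem momentum_quadForm (p : Fin (n + 1) → ℝ) :
    ∑ x, ∑ y, p x * halfDiag n x y * p y = 1 / 2 * ∑ w, p w ^ 2 := by
  have h := latticePhi4Action_halfDiag p
  unfold latticePhi4Action at h
  simp only [zero_mul, add_zero] at h
  rw [h]
  ring

/-- The positivity hypothesis of the free Schwinger–Dyson files for the momentum law:
`½ Σ p² ≤ Σ p (½𝟙) p`. -/
theorem momentum_quadForm_ge (p : Fin (n + 1) → ℝ) :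
    1 / 2 * ∑ w, p w ^ 2 ≤ ∑ x, ∑ y, p x * halfDiag n x y * p y :=
  (momentum_quadForm p).symm.le

/-- The coercivity hypothesis of the Schwinger–Dyson files for the momentum law:
`½ Σ p² − 0 ≤ S_p(p)`. -/
theorem momentum_coercive (p : Fin (n + 1) → ℝ) :
    1 / 2 * ∑ w, p w ^ 2 - 0 ≤ latticePhi4Action (halfDiag n) 0 p := by
  rw [latticePhi4Action_halfDiag]
  linarith

/-- The symmetrised diagonal coupling is the identity matrix: `(½𝟙)_{xz} + (½𝟙)_{zx} = δ_{xz}`. -/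
theorem halfDiag_add_halfDiag (x z : Fin (n + 1)) :
    halfDiag n x z + halfDiag n z x = if x = z then 1 else 0 := by
  unfold halfDiag
  by_cases h : x = z
  · subst h
    simp only [if_true]
    norm_num
  · rw [if_neg h, if_neg (fun h' => h h'.symm), if_neg h, add_zero]

/-- `Z_p` is the Gibbs mass of the diagonal free action. -/
theorem momentumZ_eq_gibbsZ : momentumZ n = gibbsZ (halfDiag n) 0 := by
  unfold momentumZ gibbsZ
  exact integral_congr_ae (Eventually.of_forall fun p => momentumWeight_eq_gibbsWeight p)

/-- **Two-point function of the refreshed momenta**: `⟨p_x p_y⟩_p = δ_{xy}`. -/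
theorem momentum_two_point (x y : Fin (n + 1)) :
    gibbsExpect (halfDiag n) 0 (fun p => p x * p y) = if x = y then 1 else 0 := by
  have h := free_propagator_sd (J := halfDiag n) (ε := 1 / 2) (by norm_num) momentum_quadForm_ge x y
  simp only [halfDiag_add_halfDiag, ite_mul, one_mul, zero_mul, Finset.sum_ite_eq,
    Finset.mem_univ, if_true] at h
  rw [h]
  by_cases hxy : x = y
  · rw [if_pos hxy, if_pos hxy.symm]
  · rw [if_neg hxy, if_neg (fun h' => hxy h'.symm)]

/-- `⟨p_x²⟩_p = 1`. -/
theorem momentum_sq (x : Fin (n + 1)) : gibbsExpect (halfDiag n) 0 (fun p => p x ^ 2) = 1 := by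
  have h := momentum_two_point (n := n) x x
  simp only [if_true] at h
  rw [← h]
  congr 1
  funext p
  ring

/-- **Four-point function of the refreshed momenta** (Wick): `⟨p_x² p_y²⟩_p = 1 + 2δ_{xy}`. -/
theorem momentum_four_point (x y : Fin (n + 1)) :
    gibbsExpect (halfDiag n) 0 (fun p => p x ^ 2 * p y ^ 2)
      = 1 + 2 * (if x = y then 1 else 0) := by
  have h := wick_four_point (J := halfDiag n) (ε := 1 / 2) (by norm_num) momentum_quadForm_ge x x y y
  have e : (fun p : Fin (n + 1) → ℝ => p x ^ 2 * p y ^ 2) = fun p => p x * p x * p y * p y := by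
    funext p
    ring
  rw [e, h, momentum_two_point, momentum_two_point, momentum_two_point]
  simp only [if_true]
  by_cases hxy : x = y
  · simp only [hxy, if_true]
    norm_num
  · simp only [hxy, if_false]
    norm_num

/-- **The total momentum has variance `V`**: `⟨(Σ_x p_x)²⟩_p = n + 1`. -/
theorem momentum_totalSq :
    gibbsExpect (halfDiag n) 0 (fun p => (∑ x, p x) ^ 2) = (n : ℝ) + 1 := by
  have h := gibbs_linear_sq_of_coercive (J := halfDiag n) (lam := 0) (ε := 1 / 2) (K := 0)
    (by norm_num) momentum_coercive (fun _ => (1 : ℝ))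
  simp only [one_mul, momentum_two_point, mul_ite, mul_one, mul_zero, Finset.sum_ite_eq,
    Finset.mem_univ, if_true, Finset.sum_const, Finset.card_univ, Fintype.card_fin,
    nsmul_eq_mul] at h
  rw [h]
  push_cast
  ring

/-- Integrability of `p_x^a p_y^b e^{−½Σp²}` in the Gibbs form. -/
theorem integrable_momentum_pow_mul_pow (x y : Fin (n + 1)) (a b : ℕ) :
    Integrable (fun p : Fin (n + 1) → ℝ => p x ^ a * p y ^ b * gibbsWeight (halfDiag n) 0 p) :=
  integrable_pow_mul_pow_mul_gibbsWeight_of_coercive (by norm_num) momentum_coercive x y a b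

/-- **The kinetic energy `½Σp²` has variance `V/2`** under the refresh law:
`⟨(½Σp² − (n+1)/2)²⟩_p = (n+1)/2`. -/
theorem momentum_kinetic_var :
    gibbsExpect (halfDiag n) 0 (fun p => ((∑ x, p x ^ 2) / 2 - ((n : ℝ) + 1) / 2) ^ 2)
      = ((n : ℝ) + 1) / 2 := by
  have hZ : 0 < gibbsZ (halfDiag n) 0 := gibbsZ_pos_of_coercive (by norm_num) momentum_coercive
  -- pointwise expansion into monomials
  have e : (fun p : Fin (n + 1) → ℝ => ((∑ x, p x ^ 2) / 2 - ((n : ℝ) + 1) / 2) ^ 2)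
      = fun p => (1 / 4 * ∑ x, ∑ y, p x ^ 2 * p y ^ 2)
          + (-(((n : ℝ) + 1) / 2) * (∑ x, p x ^ 2) + (((n : ℝ) + 1) / 2) ^ 2) := by
    funext p
    have hsq : (∑ x, p x ^ 2) ^ 2 = ∑ x, ∑ y, p x ^ 2 * p y ^ 2 := by
      rw [sq, Finset.sum_mul_sum]
    linear_combination (1 / 4 : ℝ) * hsq
  -- integrability of the pieces
  have I22 : ∀ x y : Fin (n + 1), Integrable (fun p : Fin (n + 1) → ℝ =>
      p x ^ 2 * p y ^ 2 * gibbsWeight (halfDiag n) 0 p) := fun x y =>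
    integrable_momentum_pow_mul_pow x y 2 2
  have I2 : ∀ x : Fin (n + 1), Integrable (fun p : Fin (n + 1) → ℝ =>
      p x ^ 2 * gibbsWeight (halfDiag n) 0 p) := fun x => by
    have h := integrable_momentum_pow_mul_pow x x 2 0
    simpa using h
  have Irow : ∀ x : Fin (n + 1), Integrable (fun p : Fin (n + 1) → ℝ =>
      (∑ y, p x ^ 2 * p y ^ 2) * gibbsWeight (halfDiag n) 0 p) := fun x => by
    have h := integrable_finsetSum Finset.univ (fun y (_ : y ∈ Finset.univ) => I22 x y)
    refine h.congr (Eventually.of_forall fun p => ?_)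
    simp only [Finset.sum_mul]
  have Idouble : Integrable (fun p : Fin (n + 1) → ℝ =>
      (∑ x, ∑ y, p x ^ 2 * p y ^ 2) * gibbsWeight (halfDiag n) 0 p) := by
    have h := integrable_finsetSum Finset.univ (fun x (_ : x ∈ Finset.univ) => Irow x)
    refine h.congr (Eventually.of_forall fun p => ?_)
    simp only [Finset.sum_mul]
  have Isum : Integrable (fun p : Fin (n + 1) → ℝ =>
      (∑ x, p x ^ 2) * gibbsWeight (halfDiag n) 0 p) := by
    have h := integrable_finsetSum Finset.univ (fun x (_ : x ∈ Finset.univ) => I2 x)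
    refine h.congr (Eventually.of_forall fun p => ?_)
    simp only [Finset.sum_mul]
  have Iw : Integrable (gibbsWeight (halfDiag n) 0) :=
    integrable_gibbsWeight_of_coercive (by norm_num) momentum_coercive
  have IA : Integrable (fun p : Fin (n + 1) → ℝ =>
      (1 / 4 * ∑ x, ∑ y, p x ^ 2 * p y ^ 2) * gibbsWeight (halfDiag n) 0 p) := by
    refine (Idouble.const_mul (1 / 4)).congr (Eventually.of_forall fun p => ?_)
    ring
  have IB1 : Integrable (fun p : Fin (n + 1) → ℝ =>
      (-(((n : ℝ) + 1) / 2) * ∑ x, p x ^ 2) * gibbsWeight (halfDiag n) 0 p) := by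
    refine (Isum.const_mul (-(((n : ℝ) + 1) / 2))).congr (Eventually.of_forall fun p => ?_)
    ring
  have IB2 : Integrable (fun p : Fin (n + 1) → ℝ =>
      (((n : ℝ) + 1) / 2) ^ 2 * gibbsWeight (halfDiag n) 0 p) := Iw.const_mul _
  have IB : Integrable (fun p : Fin (n + 1) → ℝ =>
      (-(((n : ℝ) + 1) / 2) * (∑ x, p x ^ 2) + (((n : ℝ) + 1) / 2) ^ 2)
        * gibbsWeight (halfDiag n) 0 p) := by
    refine (IB1.add IB2).congr (Eventually.of_forall fun p => ?_)
    simp only [Pi.add_apply]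
    ring
  -- expectations of the pieces
  have E22 : gibbsExpect (halfDiag n) 0 (fun p => ∑ x, ∑ y, p x ^ 2 * p y ^ 2)
      = ((n : ℝ) + 1) * ((n : ℝ) + 1 + 2) := by
    rw [gibbsExpect_sum (halfDiag n) 0 Finset.univ (fun x _ => Irow x)]
    have hrow : ∀ x : Fin (n + 1), gibbsExpect (halfDiag n) 0 (fun p => ∑ y, p x ^ 2 * p y ^ 2)
        = (n : ℝ) + 1 + 2 := by
      intro x
      rw [gibbsExpect_sum (halfDiag n) 0 Finset.univ (fun y _ => I22 x y)]
      simp only [momentum_four_point, Finset.sum_add_distrib, Finset.sum_const, Finset.card_univ,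
        Fintype.card_fin, nsmul_eq_mul, mul_one, mul_ite, mul_zero, Finset.sum_ite_eq,
        Finset.mem_univ, if_true]
      push_cast
      ring
    simp only [hrow, Finset.sum_const, Finset.card_univ, Fintype.card_fin, nsmul_eq_mul]
    push_cast
    ring
  have E2 : gibbsExpect (halfDiag n) 0 (fun p => ∑ x, p x ^ 2) = (n : ℝ) + 1 := by
    rw [gibbsExpect_sum (halfDiag n) 0 Finset.univ (fun x _ => I2 x)]
    simp only [momentum_sq, Finset.sum_const, Finset.card_univ, Fintype.card_fin, nsmul_eq_mul,
      mul_one]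
    push_cast
    ring
  rw [e, gibbsExpect_add (halfDiag n) 0 IA IB, gibbsExpect_const_mul, E22,
    gibbsExpect_add (halfDiag n) 0 IB1 IB2, gibbsExpect_const_mul, E2, gibbsExpect_const hZ]
  ring

/-- **Unnormalised form**: `∫ (Σ_x p_x)² e^{−½Σp²} dp = (n+1) Z_p`. -/
theorem integral_totalSq_mul_momentumWeight :
    ∫ p : Fin (n + 1) → ℝ, (∑ x, p x) ^ 2 * momentumWeight p = ((n : ℝ) + 1) * momentumZ n := by
  have hZ : 0 < gibbsZ (halfDiag n) 0 := gibbsZ_pos_of_coercive (by norm_num) momentum_coercive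
  have h := momentum_totalSq (n := n)
  unfold gibbsExpect at h
  rw [div_eq_iff hZ.ne'] at h
  rw [momentumZ_eq_gibbsZ, ← h]
  exact integral_congr_ae (Eventually.of_forall fun p => by
    simp only [momentumWeight_eq_gibbsWeight])

/-- **Unnormalised form**: `∫ (½Σp² − (n+1)/2)² e^{−½Σp²} dp = ((n+1)/2) Z_p`. -/
theorem integral_kinetic_dev_sq_mul_momentumWeight :
    ∫ p : Fin (n + 1) → ℝ, ((∑ x, p x ^ 2) / 2 - ((n : ℝ) + 1) / 2) ^ 2 * momentumWeight p
      = ((n : ℝ) + 1) / 2 * momentumZ n := by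
  have hZ : 0 < gibbsZ (halfDiag n) 0 := gibbsZ_pos_of_coercive (by norm_num) momentum_coercive
  have h := momentum_kinetic_var (n := n)
  unfold gibbsExpect at h
  rw [div_eq_iff hZ.ne'] at h
  rw [momentumZ_eq_gibbsZ, ← h]
  exact integral_congr_ae (Eventually.of_forall fun p => by
    simp only [momentumWeight_eq_gibbsWeight])

end Momenta

end Summit.Ventures.LatticeQCDFlow.Exactness
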